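import Mathlib
import HarnessLib
import HarnessLib.Audit
import Summits.CriticalPhenomena.Statement
import Literature.Probability.RandomPlanarGeometry.SAWParafermion
import Literature.Probability.RandomPlanarGeometry.SLEConvergenceCriterion
import Summits.CriticalPhenomena.SAWScalingLimit.Theorems.SAWTwistedSelfEnergyParaMartingaleDefs
import Literature.Probability.RandomPlanarGeometry.LatticeSlitIncrements
import Summits.CriticalPhenomena.SAWScalingLimit.Theorems.SAWRenewalTightnessRoomPassageEvents
import Literature.Probability.RandomPlanarGeometry.LoewnerDescription
import HarnessLib.Audit.Status.Attr

/-!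
Route: SAWAsymptoticMorera

DORMANT since 2026-08-26T07:13:01Z (reconciler: no traction for 8.4 d (last activity statement-closed at 2026-08-17T21:00:04Z); parked, not closed — `ledger route dormant route-CriticalPhenomena-SAWAsymptoticMorera --off` to reactivate) — unstaffed, not closed; items shared with open routes are served there. `ledger route dormant <id> --off` reactivates.

# Route SAWAsymptoticMorera — Z2 parafermion — asymptotic Morera + interior regularity + boundary
Riemann–Hilbert give the DCS observable, then SLE(8/3) by the martingale scheme with eventual
tightness

It suffices to show X = X_obs ∧ (I) ∧ (T). X_obs (the observable half, card
charge-and-quarter-turn-closure in corrected form):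
(r2) AsymptoticMorera — the critical square-lattice mid-edge parafermion F_δ (σ = 5/8, x = x_c,
Duminil-Copin–Smirnov's
observable transposed to δℤ², fixed reference direction at the boundary root a_δ) is holomorphic in
the limit in the
DISTRIBUTIONAL sense: for every C² bump χ supported in Ω, δ²Σ_e F_δ(e)∂̄χ(m_e) = o(δ²Σ_(m_e ∈ supp
χ) |F_δ(e)|);
(r3) InteriorRegularity — on compacts, F_δ is equicontinuous relative to its sup and sups over two
fat compacts are
comparable (Harnack); (r4) BoundaryIdentification — r2 ∧ r3 ⇒ ObservableLimitFlat, the ℤ² form of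
DCS Conjecture 2
up to a lattice constant: F_δ(z_δ)/F_δ(b_δ) → C·(φ′(z)/φ′(b))^(5/8) whenever ∂Ω is a horizontal
segment near b.
(I) SubseqIdentification (shared, stmt-CriticalPhenomena-0783): every subsequential weak limit of
the critical ℤ² SAW
laws is the chordal SLE_(8/3) law — what X_obs buys through the martingale observable (LSW03 Prop.
5.2).
(T) EventualTight (shared, stmt-CriticalPhenomena-1881): eventual tightness IsTightAlongMesh (NOT
the refuted all-δ form).
Lean: `AsymptoticMorera ∧ InteriorRegularity ∧ BoundaryIdentification ∧ SubseqIdentification ∧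
EventualTight`

## Assembly
Formally: EventualTight and SubseqIdentification give SAWScalingLimit by the tree's PROVED criterion
Literature.Probability.RandomPlanarGeometry.convergesInLawToSLE_of_isTightAlongMesh (with
IsSLECurve.map_eq_holds for uniqueness of the
SLE law, SAW.aemeasurable_curve, and the eventual probability-measure property of SAW.law from
IsEndpointApprox.reachable + finiteness of
DomainSAW in a bounded domain — the same two-paragraph proof as route SAWLeftRightFKG's assembly);
the first three hypotheses are consumed
vacuously by the term and are the ENGINE for SubseqIdentification (martingale observable ⇒ driving
process; deliberately not an item yet,
see Not decomposed yet). No new named fact is imported: every Literature constant in the items is a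
definition or a proved theorem.

Rationale: WHY THIS LINE. The Duminil-Copin–Smirnov/Smirnov programme (DuminilCopinSmirnov2012 §4 and
Conjecture 2; arXiv:1009.6077 Question 5) is the
only embedding-sensitive identification tool known for the SAW; on ℤ² no exact vertex identity
exists
(Literature.Barriers.CriticalPhenomena.not_hasExactVertexRelationZ2, proved), so "the curl vanishes
in the limit" has to become
a statement one can prove or refute. Card charge-and-quarter-turn-closure proposed a
local-equilibrium closure; planner
scrutiny (NOTES.md §Analysis) keeps its exact bookkeeping — the ℤ² vertex identity WITH REMAINDER
(support Z2VertexIdentity: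
D(v) = (δ/2)[εF♯(v) − L♯(v)], ε = x_c(1+2 sin 5π/16) − 1 ≈ 0.0094, L♯ = signed loop-return terms)
and the charge /
lattice-spin selection rules — and discards the δ-linear corrector (the order-8 winding character
averages to ZERO in any
bulk local limit, F/u ~ δ^(25/48), so there is nothing to tune) and the dressing (β is forced to 0:
|F| carries the exponent
5/8 both in the bulk and at the boundary while u vanishes like dist^(25/48); DuplantierSaleur1988,
Nienhuis1982). What
remains is a three-piece reduction of DCS Conjecture 2 on ℤ² — distributional holomorphicity (r2),
interior compactness
(r3, the continuity Ikhlef–Cardy say Morera needs, IkhlefCardy2009 §1), boundary Riemann–Hilbert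
identification (r4) —
feeding the Kemppainen–Smirnov / LSW martingale scheme (r5, r6; KemppainenSmirnov2017,
LawlerSchrammWerner2003Restriction
Prop. 5.2) whose soft step is PROVED in the tree
(Literature.Probability.RandomPlanarGeometry.convergesInLawToSLE_of_isTightAlongMesh).
Imported: discrete complex analysis (Weyl/Morera in distributional form), Coulomb-gas operator
bookkeeping as the heuristic
that ranks r2 hardest (the defect generator lives in the 3-leg, spin −3/8 class whose primary has
exactly the weights (5/8,1)
of ∂̄ψ; GorbenkoZan2020 = doi:10.1007/jhep10(2020)099 p.12: at c = 0, h̄ = 0 fields need not be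
holomorphic), Loewner
martingale identification. Versus route SAWParafermion (broken): tightness in the repaired eventual
form; the observable
crux split into typed refutable pieces with interior normalisation; a robust target (flat boundary
at b, lattice constant
C, KennedyLawler2013) instead of the exact normalisation of stmt-CriticalPhenomena-0790.

RANKED CRUXES. #0 ObservableLimitFlat (target) — robust DCS Conjecture 2 on δℤ²: there is a real
lattice constant C ≠ 0 (real by reflection symmetry; sign not claimed) such that for every Dobrushin
domain whose boundary is a horizontal segment near b (domain above), every boundary root a_δ → a
with outside neighbour a′_δ (reference direction), b_δ → b on the bottom row, interior edge (z_δ,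
w_δ) → z₀ and conformal φ : Ω → ℍ with a ↦ ∞, b ↦ 0, φ′ → c ≠ 0 at b, the boundary-normalised
mid-edge observable (F_δ(z_δ,w_δ)+F_δ(w_δ,z_δ))/F_δ(b_δ, b_δ − (0,1)) tends to C·(φ′(z₀)/c)^(5/8)
(branch continuous from b). (why it might fail: Open even on Hex (DCS Conj. 2); KennedyLawler2013:
boundary lattice effects persist in SAW limits, so C may depend on more than the flat local
environment at b, or the ratio may fail to converge when ∂Ω is rough near the root a.)
[DuminilCopinSmirnov2012, KennedyLawler2013, BeatonGuttmannJensen2012, arXiv:1009.6077]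
#2 AsymptoticMorera (crux) — card (S1)–(S4) corrected: for the critical ℤ² mid-edge parafermion F_δ
(σ = 5/8) rooted at a boundary vertex a_δ → a = D.pt 0 with fixed reference direction a′_δ → a_δ,
and every C² compactly supported χ with tsupport χ ⊆ Ω: for all ε > 0, eventually in δ → 0⁺, |δ² Σ_e
F_δ(e) ∂̄χ(m_e)| ≤ ε · δ² Σ_(m_e ∈ tsupport χ) |F_δ(e)| (the discrete distributional ∂̄ of F_δ is
o(local L¹ mass); by summation by parts this IS the smeared DCS vertex defect, hence by
Z2VertexIdentity the smeared εF♯ − L♯ must be o(δ · mass)). [difficulty: open-problem] (why it might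
fail: Z2VertexIdentity puts the defect generator in the loop-return (3-leg, spin −3/8) class whose
Coulomb-gas primary V(−1/4,3/2) has exactly the weights (5/8,1) of ∂̄ψ; at c=0, h̄=0 fields need not
be holomorphic (GorbenkoZan2020 p.12: ∂̄J zero-norm, not null); only universality says the amplitude
is 0.) [DuminilCopinSmirnov2012, arXiv:1009.6077, BeatonGuttmannJensen2012, IkhlefCardy2009,
Nienhuis1982, DuplantierSaleur1988, doi:10.1007/jhep10(2020)099,
Literature.Barriers.CriticalPhenomena.not_hasExactVertexRelationZ2]
#3 InteriorRegularity (crux) — card (PC): for the same F_δ and every compact K ⊆ Ω with non-empty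
interior: (equicontinuity) ∀ ε ∃ η, eventually in δ, |F_δ(e) − F_δ(e′)| ≤ ε · sup_K |F_δ| for medial
points in K at distance ≤ η; (Harnack) for every compact K′ ⊆ Ω with non-empty interior there is C
with sup_K |F_δ| ≤ C · sup_(K′) |F_δ| eventually. Gives precompactness in C(K) of F_δ/sup_(K₀)|F_δ|
with non-trivial subsequential limits (Arzelà–Ascoli), the continuity that turns r2 into holomorphy
of every subsequential limit (Weyl). [difficulty: open-problem] (why it might fail: No regularity
theory for SAW observables (no harmonicity, FKG or RSW; s-holomorphic tools of ChelkakSmirnov2012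
need exact relations); sub-ballisticity (DuminilCopinHammond2013) is the strongest input; |F_δ|
could oscillate at lattice scale or concentrate, breaking sup-relative equicontinuity.)
[DuminilCopinHammond2013, ChelkakSmirnov2012, KemppainenSmirnov2017, IkhlefCardy2009,
LawlerSchrammWerner2004SAW]
#4 BoundaryIdentification (crux) — glue with content (card (S5) without dressing): AsymptoticMorera
→ InteriorRegularity → ObservableLimitFlat — every subsequential limit f of F_δ/sup_(K₀)|F_δ| is
holomorphic (r2 + r3 + Weyl); the exact lattice boundary condition arg F_δ = −(5/8)·(outer normal
direction) at boundary mid-edges passes to the limit as the Riemann–Hilbert condition Im(f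
(dz)^(5/8)) = 0 on ∂Ω ∖ {a,b}; uniqueness of that RH problem in the growth class at a, b gives f =
λ(φ′)^(5/8); the flat environment at b fixes the normalisation up to the universal lattice constant
C. [deps: AsymptoticMorera, InteriorRegularity] [difficulty: L] (why it might fail: Interior control
does not reach ∂Ω: the RH condition is exact only AT boundary mid-edges, a lattice boundary layer
may decouple them from interior values; uniqueness for index 5/8 needs growth bounds at a,b and no
interior zeros; the flat-b normalisation limit may not exist (KennedyLawler2013).)
[DuminilCopinSmirnov2012, ChelkakSmirnov2012, KennedyLawler2013, Smirnov2007ICM]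
#5 SubseqIdentification (crux) — shared verbatim with routes SAWParafermion / SAWLeftRightFKG
(stmt-CriticalPhenomena-0783): for every Dobrushin domain, endpoint approximation, sequence s_n → 0⁺
and probability measure μ on CurveClass ℂ, weak convergence of the SAW laws along s_n to μ implies
IsSLELaw (8/3) D μ. Here it is what X_obs buys: ObservableLimitFlat in the slit domains Ω ∖ γ[0,t]
(flat b untouched by the exploration) makes t ↦ e^(−iσW_t) F_(Ω_t)(γ_t; z)/Z_(Ω_t)(γ_t → b) a
conformally covariant martingale with boundary exponent 5/8, which pins the driving process to
√(8/3)·B (LSW03 Prop. 5.2; tree pattern Loewner.martingale_driver_of_fkObservable for exponent 1/2)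
once KS Loewner regularity of subsequential limits is available. [deps: BoundaryIdentification]
[difficulty: open-problem] (why it might fail: SLE(8/3) is known only IF the limit is conformally
covariant (LSW04 Prediction 1); the observable route to it needs ObservableLimitFlat UNIFORMLY over
rough slit domains plus KS Loewner regularity (Condition G2), for which no SAW crossing technology
exists (KemppainenSmirnov2017 §4 omits SAW).) [LawlerSchrammWerner2004SAW,
LawlerSchrammWerner2003Restriction, KemppainenSmirnov2017, DuminilCopinSmirnov2012, Beffara2008,
Literature.Barriers.CriticalPhenomena.EmbeddingModulusUniqueness]
#6 EventualTight (crux) — shared verbatim with route SAWLeftRightFKG (stmt-CriticalPhenomena-1881):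
for every Dobrushin domain and endpoint approximation, IsTightAlongMesh (fun δ γ => γ.curve) (fun δ
=> SAW.law D δ a_δ b_δ) — eventual tightness of the critical SAW laws on CurveClass ℂ, the form the
PROVED Prokhorov criterion convergesInLawToSLE_of_isTightAlongMesh consumes; intended engine:
Kemppainen–Smirnov Condition G2 (Literature.Probability.RandomPlanarGeometry.ConditionG2) or an
Aizenman–Burchard traversal bound (sibling routes). [difficulty: open-problem] (why it might fail:
No annulus-crossing / RSW technology for the critical SAW (KS17 §4 verifies G2 for FK, percolation,
harmonic explorer, LERW only; G2 fails for UST §4.5); the refuted all-δ form stmt-0772 is avoided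
(eventual filter) but even eventual tightness has no engine beyond sub-ballisticity.)
[Summit.CriticalPhenomena.SAWScalingLimit.Theorems.SAWParafermionTight_refuted,
KemppainenSmirnov2017, AizenmanBurchardDuke1999, DuminilCopinHammond2013]
#9 Z2VertexIdentity (support) — the EXACT square-lattice analogue of DCS Lemma 1, with remainder
(card (S1) made precise; outside the proved barrier's scope, caveat (b) of
NienhuisWeightsExcludeVertexSAW): for δ > 0, a root a with reference site a′, and an interior vertex
v ≠ a with its four neighbours in Ω_δ, writing H(p,q) for the half-edge term (walks to p, half-step
toward q), T_d for its 'type-1' part at (v−d, v) (walks to v−d never visiting v) and L_d := H(v−d,v)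
− T_d (loop returns): Σ_d d·(H(v,v+d)+H(v+d,v)) = (x_c(1+2 sin(5π/16)) − 1)·Σ_d d·T_d − Σ_d d·L_d.
Proof = DCS's regrouping (walks to v grouped by last step; left/right turns contribute i e^(−i5π/16)
− i e^(i5π/16) = 2 sin(5π/16)) adapting HexParafermionProofs; the intended strengthening (not
filed): L_d is a sum over loop-reversal PAIRS with coefficients 2 sin(15π/16) (opposite exits) and i
e^(−15iπ/16) + e^(5iπ/8) (adjacent exits), loop orientation being forced by planarity as in
wnd_eq_zero_of_simplyConnected. [difficulty: M] [DuminilCopinSmirnov2012,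
Literature.Probability.RandomPlanarGeometry.SAW.DuminilCopinSmirnov2012_lemma1_holds,
Literature.Barriers.CriticalPhenomena.NienhuisWeightsExcludeVertexSAW, BeatonGuttmannJensen2012]

TWO-LAYER PLAN. AsymptoticMorera ⇐ ChargedLocalEquilibrium (smeared one-point functions of local
charge-5, lattice-spin −3/8 observables span, to order
δ^(9/4), a space of dimension ≤ 2: the card's ν* idea moved to the charged sector) →
DefectAmplitudeVanishes (the generator εF♯ − L♯ has
no component on the weight-(5/8,1) field) → AsymptoticMorera (k = 2). InteriorRegularity ⇐
HarnackComparability → SupEquicontinuity →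
InteriorRegularity. BoundaryIdentification ⇐ BoundaryModulusControl (no boundary layer: interior sup
≍ boundary half-edge terms) →
RHUniqueness58 (index-5/8 Riemann–Hilbert uniqueness in the growth class) → BoundaryIdentification.
Nothing here is filed now.

KILL CRITERIA. ¬AsymptoticMorera (first numerically: the ratio in r2 not decaying on 20–60-site
boxes/strips; then a proof that the smeared defect has a
non-zero limit along a subsequence) closes the route `refuted:AsymptoticMorera` and sinks
SAWParafermion's r2 and every ℤ² parafermion card
with it. ¬ObservableLimitFlat with r2, r3 standing ⇒ pivot the target to interior normalisation
(F_δ(z_δ)/F_δ(z′_δ) → (φ′(z)/φ′(z′))^(5/8))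
and move the constant into the martingale step. ¬SubseqIdentification (a non-SLE(8/3) subsequential
limit) or ¬EventualTight kill the
conjunct as typed (summit-level event). Proofs of SAWHexUniversality.LatticeUniversality +
HexConjecture, or of SAWRestrictionRigidity's
cruxes, moot the route (close superseded).

NOT DECOMPOSED YET. The martingale step ObservableLimitFlat(uniform over slit domains) ⇒ driving
process √(8/3)B (far-field expansion of (φ_t′)^(5/8), the
5/8-analogue of Loewner.martingale_driver_of_fkObservable) and KS Condition G2 for SAW (behind
r5/r6) — not items until r2/r3 move; the
boundary analysis inside r4 (RH uniqueness with index 5/8, boundary layer, flat-b constant); the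
pair-structure strengthening of
Z2VertexIdentity and the isotropy companion F_δ(horizontal) − F_δ(vertical) = o(sup) (spin-2
component; predicted gap ≈ 1.26); all
constants/rates in r2 (no rate is claimed). Deliberately DROPPED from the card: tuned stencil (no
covariant freedom in 4-term stencils),
δ-linear corrector, dressing exponents β_k (forced to 0).

CHEAPEST FALSIFIER. Exact enumeration / transfer matrices on ℤ² (the BeatonGuttmannJensen2012
machinery, or kit): root a at the midpoint of the bottom side of an
L×L box, L = 16…64, χ a fixed bump of diameter L/2 at the centre; compute R(L) = |Σ_e F(e)∂̄χ(m_e)|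
/ Σ_(supp χ)|F(e)| at x_c = 0.3790522775,
σ = 5/8. Asymptotic Morera predicts R(L) → 0 (a power law); R(L) → const > 0 kills r2, this route
and DCS Conjecture 2 on ℤ². Evidence in
print is favourable but indirect: on square strips the boundary form of the identity holds
asymptotically, cos(3π/8)A_T + B_T →
1.024966(1 − 0.14/T²) (BeatonGuttmannJensen2012 pp. 5, 10). Not run this session (compute/lit
services partly unavailable; recorded in NOTES.md).

NUMBERS. x_c(ℤ²) = 1/μ = 0.3790522775(5), μ = 2.63815853 (BeatonGuttmannJensen2012); 1 + 2
sin(5π/16) = 2.662939, so ε = x_c·2.662939 − 1 = +0.0094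
(the type-1/2 groups would cancel iff μ = 2.662939); loop-pair coefficients |2 sin(15π/16)| = 0.390
(opposite exits), |i e^(−15iπ/16) +
e^(5iπ/8)| = 0.196 (adjacent exits) vs 0 on Hex at σ = 5/8; exponents (Nienhuis1982,
DuplantierSaleur1988; Coulomb gas g = 3/2):
boundary 1-leg 5/8 = bulk parafermion dimension, bulk 1-leg 5/48, so |F|/u ~ δ^(25/48); winding cost
x(σ′) − 5/48 = 4σ′²/3 and h̄(σ′) = 0
iff σ′ ∈ {1/8, 5/8}; ∂̄ψ has weights (5/8, 1) = weights of the 3-leg primary V(−1/4, 3/2). Items at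
open: 8 (5 cruxes, 1 target,
1 support, 1 assembly).

DEFINITION REQUESTS. None required (all statements inline over SAWParafermion.lean /
SLEConvergenceCriterion.lean objects). Nice-to-have, not filed: a named
`SAW.lastStepTerm` / `SAW.loopReturnTerm` to shorten Z2VertexIdentity;
`Literature.Probability.RandomPlanarGeometry.ConditionG2` already
exists for a later KS item.

Novelty: Searches (2026-08-15): local `lit search` index unavailable this session (searchd connection reset
×3, recorded); `lit search --source s2
"parafermionic observable self-avoiding walk square lattice"` (12 rows; relevant: arXiv:1110.1141);
`lit search --source zbmath "parafermionic
observable discrete holomorphicity"` (3: arXiv:1007.0575, arXiv:1207.3883 Alam–Batchelor,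
arXiv:1210.5036 de Gier–Lee–Rasmussen);
`lit search --source crossref "Duplantier Saleur winding angle self-avoiding walk"` (8;
doi:10.1103/physrevlett.60.2343); `lit search
--source crossref "Gorbenko Zan O(n) models logarithmic CFT"` (8; doi:10.1007/jhep10(2020)099, READ
p.12 via lit read arXiv:2005.07708);
openalex/arxiv cascades rate-limited (HTTP 429), galaxy unreachable; barrier files
NienhuisWeightsExcludeVertexSAW / ParafermionicHalfCauchyRiemann
/ EmbeddingModulusUniqueness read; tree files SAWParafermion.lean, HexParafermion*.lean,
SLEConvergenceCriterion.lean, Observable*.lean read.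
Nearest prior art found: DuminilCopinSmirnov2012 §4 + Conjecture 2 (curl 'expected to vanish in the
limit', no mechanism); arXiv:1009.6077
Q5 ('establish preholomorphicity approximately, with estimates'); BeatonGuttmannJensen2012
(numerical asymptotic validity of the DCS identity
on ℤ² strips with renormalised constants); IkhlefCardy2009 §3 / arXiv:1207.3883 (exact
holomorphicity ⇔ integrable weights); route
SAWParafermion (stmt-CriticalPhenomena-0790, undecomposed, exact normalisation, refuted tightness
form).
Delta: the  [refs: 10.1103/physrevlett.60.2343, 10.1007/jhep10(2020, 1110.1141, 1007.0575, 1207.3883, 1210.5036, 2005.07708, 1009.6077, doi:10.1103/physrevlett.60.2343, doi:10.1007/jhep10, DuminilCopinSmirnov2012, BeatonGuttmannJensen2012, IkhlefCardy2009]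

Barriers (technique_class: approximate-holomorphicity; martingale-observable): - technique_class: approximate-holomorphicity; martingale-observable
- Literature.Barriers.CriticalPhenomena.NienhuisWeightsExcludeVertexSAW: evaded in statement — no
exact 4-term relation is used anywhere (not_hasExactVertexRelationZ2 is respected); Z2VertexIdentity
is an identity WITH REMAINDER, explicitly outside the barrier's scope (its caveat (b)); r2 speaks
about the limit only.
- Literature.Barriers.CriticalPhenomena.ParafermionicHalfCauchyRiemann: accepted — F_δ is never
reconstructed at fixed δ; determination happens in the limit by Morera/Weyl, and the continuity this
needs (Ikhlef–Cardy) is filed as its own crux r3 instead of being assumed.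
- Literature.Barriers.CriticalPhenomena.EmbeddingModulusUniqueness: the route is embedding-sensitive
— r2 is FALSE for a sheared ℤ² with the unsheared ∂̄ (Beffara's pushed-forward limit is holomorphic
only in sheared coordinates), so D4 is spent inside the statement of r2; honest caveat: no mechanism
here USES the quarter-turn beyond selection rules, which do not suffice (r2 why-might-fail) — the
bet is that regularity (r3) plus a global input closes the amplitude identity.
- Literature.Barriers.CriticalPhenomena.SAWNoUnitaryCFT: no unitarity or reflection positivity is
used; the c = 0 logarithmic structure (doi:10.1007/jhep10(2020)099) is named as the danger for r2,
not assumed away.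
- Literature.Barriers.CriticalPhenomena.SAWNotKineticallyGrown: only the fixed-fugacity two-point
ensemble and its exact domain-Markov property en

History (route lifecycle, newest last):
- 2026-08-15T12:18:45Z · rev 1: restated Assembly (stmt-CriticalPhenomena-6860) — assembly: inline the r6 tightness hypothesis (statement of stmt-1881) instead of the decl name EventualTight, whose wanted_by entry for this route carries no de (planner-plancard-CriticalPhenomena-SAWScaling-84ef3e55-0)
- 2026-08-16T02:18:11Z · AUTO-CRUX: 1 conjecture-grade item(s) promoted to crux (ObservableLimitFlat) — refuter vetting / tiering apply (operator:999:1362873)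
- 2026-08-16T03:59:35Z · AUTO-CRUX (backfill): ObservableLimitFlat — hypotheses of the deciding theorem that nothing in the route derives are cruxes (operator:999:1085951)
- 2026-08-26T07:13:01Z · DORMANT — reconciler: no traction for 8.4 d (last activity statement-closed at 2026-08-17T21:00:04Z); parked, not closed — `ledger route dormant route-CriticalPhenomena-S (operator:999:3391111)

sub-problem: SAWScalingLimit · status: dormant · opened planner-plancard-CriticalPhenomena-SAWScaling-84ef3e55-0 2026-08-15T11:54:18Z · rev 7 · ledger route-CriticalPhenomena-SAWAsymptoticMorera
GENERATED by the gate from the ledger (D-0016/17). Provers cite these decls: `theorem foo : Summit.CriticalPhenomena.SAWScalingLimit.Theses.SAWAsymptoticMorera.<Decl> := …` in Summits/CriticalPhenomena/SAWScalingLimit/Theorems/<Name>.lean.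
-/

namespace Summit.CriticalPhenomena.SAWScalingLimit.Theses.SAWAsymptoticMorera

open scoped BigOperators Topology Manifold Classical MeasureTheory ProbabilityTheory Matrix InnerProductSpace ComplexConjugate ContinuousMap
open Filter Set Function TopologicalSpace MeasureTheory

attribute [summit_statement] _root_.SAWScalingLimit

/-- item stmt-CriticalPhenomena-6855 · crux (kind.auto-crux: conjecture-grade) · rank 0 · open · by planner
why it might fail: Open even on Hex (DCS Conj. 2; Smirnov ICM 2010 Q5). KennedyLawler2013: boundary lattice effects persist in SAW scaling limits, so the constant C may depend on more than the flat environment at b, and the boundary-normalised ratio may fail to converge when ∂Ω is rough near the root a.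
sources: DuminilCopinSmirnov2012, Smirnov2010ICM, KennedyLawler2013, BeatonGuttmannJensen2012
[target] robust DCS Conjecture 2 on δℤ²: there is a real lattice constant C ≠ 0 (real by reflection
symmetry; sign not claimed) such that for every Dobrushin domain whose boundary is a horizontal
segment near b (domain above), every boundary root a_δ → a with outside neighbour a′_δ (reference
direction), b_δ → b on the bottom row, interior edge (z_δ, w_δ) → z₀ and conformal φ : Ω → ℍ with a
↦ ∞, b ↦ 0, φ′ → c ≠ 0 at b, the boundary-normalised mid-edge observable
(F_δ(z_δ,w_δ)+F_δ(w_δ,z_δ))/F_δ(b_δ, b_δ − (0,1)) tends to C·(φ′(z₀)/c)^(5/8) (branch continuous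
from b). -/
@[route_item "route-CriticalPhenomena-SAWAsymptoticMorera", crux]
def ObservableLimitFlat : Prop :=
  ∃ C : ℝ, C ≠ 0 ∧ ∀ (D : Literature.Probability.RandomPlanarGeometry.DobrushinDomain) (a a' b z w : ℝ → Literature.Probability.LatticeModels.Site 2) (z₀ : ℂ) (r : ℝ) (Φ : Literature.Probability.RandomPlanarGeometry.ConformalEquiv D.carrier UpperHalfPlane.upperHalfPlaneSet) (L : ℂ → ℂ) (c : ℂ), let H : ℝ → Literature.Probability.LatticeModels.Site 2 → Literature.Probability.LatticeModels.Site 2 → ℂ := fun δ p q => ∑' γ : Literature.Probability.RandomPlanarGeometry.SAW.DomainSAW D.carrier δ (a δ) p, if s(p, q) ∈ γ.walk.edges then 0 else Complex.exp (-Complex.I * (5 / 8 : ℂ) * (Literature.Probability.LatticeModels.winding (Literature.Probability.LatticeModels.meshPoint δ (a' δ) :: (γ.walk.support.map (Literature.Probability.LatticeModels.meshPoint δ)) ++ [Literature.Probability.LatticeModels.medialPoint δ s(p, q)]) : ℝ)) * (Literature.Probability.RandomPlanarGeometry.SAW.criticalFugacity : ℂ) ^ (γ.length + 1); (∀ᶠ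 δ in nhdsWithin 0 (Set.Ioi 0), a δ ∈ Literature.Probability.LatticeModels.meshDomain D.carrier δ ∧ (Literature.Probability.LatticeModels.zdGraph 2).Adj (a δ) (a' δ) ∧ Literature.Probability.LatticeModels.meshPoint δ (a' δ) ∉ D.carrier ∧ b δ ∈ Literature.Probability.LatticeModels.meshDomain D.carrier δ ∧ Literature.Probability.LatticeModels.meshPoint δ (b δ + ![0, -1]) ∉ D.carrier ∧ (Literature.Probability.LatticeModels.discreteDomainGraph D.carrier δ).Adj (z δ) (w δ)) → Filter.Tendsto (fun δ => Literature.Probability.LatticeModels.meshPoint δ (a δ)) (nhdsWithin 0 (Set.Ioi 0)) (nhds (D.pt 0)) → Filter.Tendsto (fun δ => Literature.Probability.LatticeModels.meshPoint δ (b δ)) (nhdsWithin 0 (Set.Ioi 0)) (nhds (D.pt 1)) → 0 < r → Metric.ball (D.pt 1) r ∩ D.carrier = Metric.ball (D.pt 1) r ∩ {ζ | (D.pt 1).im < ζ.im} → z₀ ∈ D.carrier → Filter.Tendsto (fun δ => Literature.Probability.LatticeModels.meshPoint δ (z δ)) (nhdsWithin 0 (Set.Ioi 0)) (nhds z₀)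 → Filter.Tendsto (fun x => ‖Φ x‖) (nhdsWithin (D.pt 0) D.carrier) Filter.atTop → Φ.HasBoundaryValue (D.pt 1) 0 → c ≠ 0 → Filter.Tendsto (deriv Φ) (nhdsWithin (D.pt 1) D.carrier) (nhds c) → ContinuousOn L D.carrier → (∀ x ∈ D.carrier, Complex.exp (L x) = deriv Φ x / c) → Filter.Tendsto L (nhdsWithin (D.pt 1) D.carrier) (nhds 0) → Filter.Tendsto (fun δ => (H δ (z δ) (w δ) + H δ (w δ) (z δ)) / H δ (b δ) (b δ + ![0, -1])) (nhdsWithin 0 (Set.Ioi 0)) (nhds ((C : ℂ) * Complex.exp ((5 / 8 : ℂ) * L z₀)))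

/-- item stmt-CriticalPhenomena-6856 · crux · rank 2 · open · by planner
why it might fail: On ℤ² the DCS identity has a remainder (exact only for Glazman's turn-weighted walk); Z2VertexIdentity puts the defect in the loop-return (3-leg) class whose Coulomb-gas primary has the weights (5/8,1) of ∂̄ψ; at c=0 such an h̄=0 field need not vanish (GorbenkoZan p.12); only universality says so.
sources: DuminilCopinSmirnov2012, Smirnov2010ICM, BeatonGuttmannJensen2012, Glazman2015WeightedSAW, IkhlefCardy2009, Nienhuis1982
[crux] card (S1)–(S4) corrected: for the critical ℤ² mid-edge parafermion F_δ (σ = 5/8) rooted at a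
boundary vertex a_δ → a = D.pt 0 with fixed reference direction a′_δ → a_δ, and every C² compactly
supported χ with tsupport χ ⊆ Ω: for all ε > 0, eventually in δ → 0⁺, |δ² Σ_e F_δ(e) ∂̄χ(m_e)| ≤ ε ·
δ² Σ_(m_e ∈ tsupport χ) |F_δ(e)| (the discrete distributional ∂̄ of F_δ is o(local L¹ mass); by
summation by parts this IS the smeared DCS vertex defect, hence by Z2VertexIdentity the smeared εF♯
− L♯ must be o(δ · mass)). [difficulty: open-problem] -/
@[route_item "route-CriticalPhenomena-SAWAsymptoticMorera", crux]
def AsymptoticMorera : Prop :=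
  ∀ (D : Literature.Probability.RandomPlanarGeometry.DobrushinDomain) (a a' : ℝ → Literature.Probability.LatticeModels.Site 2) (χ : ℂ → ℂ), let H : ℝ → Literature.Probability.LatticeModels.Site 2 → Literature.Probability.LatticeModels.Site 2 → ℂ := fun δ p q => ∑' γ : Literature.Probability.RandomPlanarGeometry.SAW.DomainSAW D.carrier δ (a δ) p, if s(p, q) ∈ γ.walk.edges then 0 else Complex.exp (-Complex.I * (5 / 8 : ℂ) * (Literature.Probability.LatticeModels.winding (Literature.Probability.LatticeModels.meshPoint δ (a' δ) :: (γ.walk.support.map (Literature.Probability.LatticeModels.meshPoint δ)) ++ [Literature.Probability.LatticeModels.medialPoint δ s(p, q)]) : ℝ)) * (Literature.Probability.RandomPlanarGeometry.SAW.criticalFugacity : ℂ) ^ (γ.length + 1); let dir : Fin 2 → Literature.Probability.LatticeModels.Site 2 := ![![1, 0], ![0, 1]]; let M : ℝ → ℂ := fun δ => (δ : ℂ) ^ 2 * ∑' v : Literature.Probability.LatticeModels.Site 2, ∑ k : Fin 2, (H δ v (v + dir k) + H δ (v + dir k) v) * ((fderiv ℝ χ (Literature.Probability.LatticeModels.medialPoint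 δ s(v, v + dir k)) 1 + Complex.I * fderiv ℝ χ (Literature.Probability.LatticeModels.medialPoint δ s(v, v + dir k)) Complex.I) / 2); let N : ℝ → ℝ := fun δ => δ ^ 2 * ∑' v : Literature.Probability.LatticeModels.Site 2, ∑ k : Fin 2, (if Literature.Probability.LatticeModels.medialPoint δ s(v, v + dir k) ∈ tsupport χ then ‖H δ v (v + dir k) + H δ (v + dir k) v‖ else 0); (∀ᶠ δ in nhdsWithin 0 (Set.Ioi 0), a δ ∈ Literature.Probability.LatticeModels.meshDomain D.carrier δ ∧ (Literature.Probability.LatticeModels.zdGraph 2).Adj (a δ) (a' δ) ∧ Literature.Probability.LatticeModels.meshPoint δ (a' δ) ∉ D.carrier) → Filter.Tendsto (fun δ => Literature.Probability.LatticeModels.meshPoint δ (a δ)) (nhdsWithin 0 (Set.Ioi 0)) (nhds (D.pt 0)) → ContDiff ℝ 2 χ → HasCompactSupport χ → tsupport χ ⊆ D.carrier → ∀ ε > 0, ∀ᶠ δ in nhdsWithin 0 (Set.Ioi 0), ‖M δ‖ ≤ ε * N δ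

/-- item stmt-CriticalPhenomena-6857 · crux · rank 3 · open · by planner
why it might fail: No regularity theory for SAW observables (no harmonicity/FKG/RSW; s-holomorphic tools need exact relations; sub-ballisticity is the strongest input): |F_δ| may oscillate or concentrate at lattice scale; equicontinuity across edge orientations also asserts isotropy F_h − F_v = o(sup), predicted only.
sources: DuminilCopinHammond2013, ChelkakSmirnov2012, KemppainenSmirnov2017, IkhlefCardy2009, LawlerSchrammWerner2004SAW, Nienhuis1982
[crux] card (PC): for the same F_δ and every compact K ⊆ Ω with non-empty interior: (equicontinuity)
∀ ε ∃ η, eventually in δ, |F_δ(e) − F_δ(e′)| ≤ ε · sup_K |F_δ| for medial points in K at distance ≤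
η; (Harnack) for every compact K′ ⊆ Ω with non-empty interior there is C with sup_K |F_δ| ≤ C ·
sup_(K′) |F_δ| eventually. Gives precompactness in C(K) of F_δ/sup_(K₀)|F_δ| with non-trivial
subsequential limits (Arzelà–Ascoli), the continuity that turns r2 into holomorphy of every
subsequential limit (Weyl). [difficulty: open-problem] -/
@[route_item "route-CriticalPhenomena-SAWAsymptoticMorera", crux]
def InteriorRegularity : Prop :=
  ∀ (D : Literature.Probability.RandomPlanarGeometry.DobrushinDomain) (a a' : ℝ → Literature.Probability.LatticeModels.Site 2), let H : ℝ → Literature.Probability.LatticeModels.Site 2 → Literature.Probability.LatticeModels.Site 2 → ℂ := fun δ p q => ∑' γ : Literature.Probability.RandomPlanarGeometry.SAW.DomainSAW D.carrier δ (a δ) p, if s(p, q) ∈ γ.walk.edges then 0 else Complex.exp (-Complex.I * (5 / 8 : ℂ) * (Literature.Probability.LatticeModels.winding (Literature.Probability.LatticeModels.meshPoint δ (a' δ) :: (γ.walk.support.map (Literature.Probability.LatticeModels.meshPoint δ)) ++ [Literature.Probability.LatticeModels.medialPoint δ s(p, q)]) : ℝ)) * (Literature.Probability.RandomPlanarGeometry.SAW.criticalFugacity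 : ℂ) ^ (γ.length + 1); let dir : Fin 2 → Literature.Probability.LatticeModels.Site 2 := ![![1, 0], ![0, 1]]; let F : ℝ → Literature.Probability.LatticeModels.Site 2 × Fin 2 → ℂ := fun δ e => H δ e.1 (e.1 + dir e.2) + H δ (e.1 + dir e.2) e.1; let m : ℝ → Literature.Probability.LatticeModels.Site 2 × Fin 2 → ℂ := fun δ e => Literature.Probability.LatticeModels.medialPoint δ s(e.1, e.1 + dir e.2); let S : Set ℂ → ℝ → ℝ := fun K δ => ⨆ e : Literature.Probability.LatticeModels.Site 2 × Fin 2, (if m δ e ∈ K then ‖F δ e‖ else 0); (∀ᶠ δ in nhdsWithin 0 (Set.Ioi 0), a δ ∈ Literature.Probability.LatticeModels.meshDomain D.carrier δ ∧ (Literature.Probability.LatticeModels.zdGraph 2).Adj (a δ) (a' δ) ∧ Literature.Probability.LatticeModels.meshPoint δ (a' δ) ∉ D.carrier) → Filter.Tendsto (fun δ => Literature.Probability.LatticeModels.meshPoint δ (a δ)) (nhdsWithin 0 (Set.Ioi 0)) (nhds (D.pt 0)) → ∀ K : Set ℂ, IsCompact K → K ⊆ D.carrier → (interior K).Nonempty →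 (∀ ε > 0, ∃ η > 0, ∀ᶠ δ in nhdsWithin 0 (Set.Ioi 0), ∀ e e' : Literature.Probability.LatticeModels.Site 2 × Fin 2, m δ e ∈ K → m δ e' ∈ K → ‖m δ e - m δ e'‖ ≤ η → ‖F δ e - F δ e'‖ ≤ ε * S K δ) ∧ (∀ K' : Set ℂ, IsCompact K' → K' ⊆ D.carrier → (interior K').Nonempty → ∃ C : ℝ, ∀ᶠ δ in nhdsWithin 0 (Set.Ioi 0), S K δ ≤ C * S K' δ)

/-- item stmt-CriticalPhenomena-6858 · crux · rank 4 · open · by planner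
why it might fail: Interior control does not reach ∂Ω: arg F = −(5/8)·normal is exact only AT boundary mid-edges, a lattice boundary layer may decouple them from interior values; RH uniqueness at index 5/8 needs growth bounds at a, b and no interior zeros; the flat-b normalising limit may not exist (KennedyLawler).
sources: DuminilCopinSmirnov2012, ChelkakSmirnov2012, KennedyLawler2013, Smirnov2007ICM
[crux] glue with content (card (S5) without dressing): AsymptoticMorera → InteriorRegularity →
ObservableLimitFlat — every subsequential limit f of F_δ/sup_(K₀)|F_δ| is holomorphic (r2 + r3 +
Weyl); the exact lattice boundary condition arg F_δ = −(5/8)·(outer normal direction) at boundary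
mid-edges passes to the limit as the Riemann–Hilbert condition Im(f (dz)^(5/8)) = 0 on ∂Ω ∖ {a,b};
uniqueness of that RH problem in the growth class at a, b gives f = λ(φ′)^(5/8); the flat
environment at b fixes the normalisation up to the universal lattice constant C. [deps:
AsymptoticMorera, InteriorRegularity] [difficulty: L] -/
@[route_item "route-CriticalPhenomena-SAWAsymptoticMorera", crux]
def BoundaryIdentification : Prop :=
  AsymptoticMorera → InteriorRegularity → ObservableLimitFlat

/-- item stmt-CriticalPhenomena-0783 · crux · rank 5 · SPLIT (gen 1) into SlitParaObservableUniform, ParaMartingalesOfSlitUniform, LimitsDescribable, EndpointRobust + glue SubseqIdentificationOfParaSubs · direct attempts still welcome (low priority) · by planner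
why it might fail: SLE(8/3) is known only IF the limit is conformally covariant (LSW04 Prediction 1); the observable route needs ObservableLimitFlat UNIFORMLY over rough slit domains plus KS Loewner regularity (Condition G2); no SAW crossing technology exists (KS17 §4: FK, percolation, harmonic explorer, LERW only).
sources: LawlerSchrammWerner2004SAW, LawlerSchrammWerner2003Restriction, KemppainenSmirnov2017, DuminilCopinSmirnov2012, Beffara2008Universal, Literature.Barriers.CriticalPhenomena.EmbeddingModulusUniqueness
[crux] r3: identification of subsequential limits — for every Dobrushin domain D, endpoint
approximation (a_δ,b_δ), sequence s_n → 0+ and probability measure μ on CurveClass ℂ, if ∫ f∘curve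
d(Literature.Probability.RandomPlanarGeometry.SAW.law D (s n) …) → ∫ f dμ for all bounded continuous
f then μ is the chordal SLE_{8/3} law in D (Literature.Probability.RandomPlanarGeometry.IsSLELaw
(8/3) D μ). Obtained from r2 (observable limit) by the martingale principle (LSW03
arXiv:math/0209343 Prop. 5.2: κ = 8/3 is singled out by the 5/8-observable), or from restriction
(sibling route). -/
@[route_item "route-CriticalPhenomena-SAWAsymptoticMorera", crux]
def SubseqIdentification : Prop :=
  ∀ (D : Literature.Probability.RandomPlanarGeometry.DobrushinDomain) (a b : ℝ → Literature.Probability.LatticeModels.Site 2), Literature.Probability.RandomPlanarGeometry.SAW.IsEndpointApprox D a b → ∀ (s : ℕ → ℝ) (μ : MeasureTheory.Measure (Literature.Probability.RandomPlanarGeometry.CurveClass ℂ)), Filter.Tendsto s Filter.atTop (nhdsWithin 0 (Set.Ioi 0)) → MeasureTheory.IsProbabilityMeasure μ → (∀ f : BoundedContinuousFunction (Literature.Probability.RandomPlanarGeometry.CurveClass ℂ) ℝ, Filter.Tendsto (fun n => ∫ γ, f γ.curve ∂(Literature.Probability.RandomPlanarGeometry.SAW.law D.carrier (s n) (a (s n))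 (b (s n)))) Filter.atTop (nhds (∫ x, f x ∂μ))) → Literature.Probability.RandomPlanarGeometry.IsSLELaw ((8 : NNReal) / 3) D μ

-- parent: SubseqIdentification · child (gen 1)
/--     item stmt-CriticalPhenomena-20253 · crux · rank 501 · open
    parent: SubseqIdentification · by operator
    why it might fail: Square lattice has no exact parafermionic vertex relation (only Z2VertexIdentity with defect) and no discrete boundary-value control in slit domains; uniformity over rough capped pasts is Duminil-Copin–Smirnov Conj.2-strength and may fail at atypical pasts (fjords) even if true for smooth domains.
    sources: DuminilCopinSmirnov2012, arXiv:1007.0575, LawlerSchrammWerner2004SAW, arXiv:math/0204277, BeatonGuttmannJensen2012, arXiv:1110.1141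
[crux] (S2 of line parafermionic-martingale, verbatim) For a lattice-rooted approximation (a,a',b)
of D and a chordal uniformiser φ: at every interior point φ(w), the Doob-normalised spin-5/8 vertex
observable paraDoob of the SAW exploration, evaluated at capped pasts (capTime ≤ (Im w)²/16), is
eventually uniformly bounded and converges, uniformly over pasts off the no-return event, to the
explicit hull functional hullParaObs(pastHull, drivingValue, w) — normalisation-free (Doob ratio),
slit-uniform. The honest output an OBSERVABLE engine must deliver for identification; this route's
r2–r4 (AsymptoticMorera / InteriorRegularity / BoundaryIdentification) give the SMOOTH-domain half,
the slit-uniform upgrade is the open core (DCS 2012 Conj. 2 strength). -/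
@[route_item "route-CriticalPhenomena-SAWAsymptoticMorera"]
def SlitParaObservableUniform : Prop :=
  ∀ (D : Literature.Probability.RandomPlanarGeometry.DobrushinDomain) (a a' b : ℝ → Literature.Probability.LatticeModels.Site 2) (φ : Literature.Probability.RandomPlanarGeometry.ConformalEquiv UpperHalfPlane.upperHalfPlaneSet D.carrier), Summit.CriticalPhenomena.SAWScalingLimit.Theorems.SubseqIdentification.ParaMartingale.IsLatticeRooted D a a' b → D.IsChordalUniformizing φ → ∀ w : ℂ, 0 < w.im → ∀ (zδ : ℝ → Literature.Probability.LatticeModels.Site 2), Filter.Tendsto (fun δ => Literature.Probability.LatticeModels.meshPoint δ (zδ δ)) (nhdsWithin 0 (Set.Ioi 0)) (nhds (φ w)) → (∃ C : ℝ, ∀ᶠ δ in nhdsWithin (0 : ℝ) (Set.Ioi 0), ∀ (γ : Literature.Probability.RandomPlanarGeometry.SAW.DomainSAW D.carrier δ (a δ) (b δ)) (k : ℕ), Literature.Probability.RandomPlanarGeometry.LatticeSlit.capTime φ (Summit.CriticalPhenomena.SAWScalingLimit.Theorems.SubseqIdentification.RoomEntropy.prefixAt γ k) ≤ w.im ^ 2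 / 16 → ‖Summit.CriticalPhenomena.SAWScalingLimit.Theorems.SubseqIdentification.ParaMartingale.paraDoob D δ (a δ) (a' δ) (b δ) (zδ δ) γ k‖ ≤ C) ∧ ∀ ε : ℝ, 0 < ε → ∃ R : ℝ, 0 < R ∧ ∀ r : ℝ, 0 < r → r < R → ∀ᶠ δ in nhdsWithin (0 : ℝ) (Set.Ioi 0), ∀ (γ : Literature.Probability.RandomPlanarGeometry.SAW.DomainSAW D.carrier δ (a δ) (b δ)), γ ∉ Summit.CriticalPhenomena.SAWScalingLimit.Theorems.SubseqIdentification.RoomEntropy.noReturnEvent D δ (a δ) (b δ) R r → ∀ k : ℕ, Literature.Probability.RandomPlanarGeometry.LatticeSlit.capTime φ (Summit.CriticalPhenomena.SAWScalingLimit.Theorems.SubseqIdentification.RoomEntropy.prefixAt γ k) ≤ w.im ^ 2 / 16 → ‖Summit.CriticalPhenomena.SAWScalingLimit.Theorems.SubseqIdentification.ParaMartingale.paraDoob D δ (a δ) (a' δ) (b δ) (zδ δ) γ k - Summit.CriticalPhenomena.SAWScalingLimit.Theorems.SubseqIdentification.ParaMartingale.hullParaObs (Literature.Probability.RandomPlanarGeometry.LatticeSlit.pastHull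 φ (Summit.CriticalPhenomena.SAWScalingLimit.Theorems.SubseqIdentification.RoomEntropy.prefixAt γ k)) (Literature.Probability.RandomPlanarGeometry.LatticeSlit.drivingValue φ (Summit.CriticalPhenomena.SAWScalingLimit.Theorems.SubseqIdentification.RoomEntropy.prefixAt γ k)) w‖ ≤ ε

-- parent: SubseqIdentification · child (gen 1)
/--     item stmt-CriticalPhenomena-20254 · crux · rank 502 · open
    parent: SubseqIdentification · by operator
    why it might fail: Joint convergence of lattice drivers with the curve needs a priori regularity (no long fjords at capped capacity) beyond the landed no-return estimate; the passage needs the S2 bound uniform in δ at capped times — a cap mismatch (lattice capTime vs limit capacity) breaks the stopped-value pairing.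
    sources: KemppainenSmirnov2017, arXiv:1212.6215, LawlerSchrammWerner2004, arXiv:math/0112234, Kennedy2008Driving
[crux] (bridge; packages S3a ParaLatticeDrivers + S3c ParaPassageAssembly of the line) S2 ⇒ every
describable probability subsequential limit μ of the SAW laws of a lattice-rooted approximation
carries, for every interior w, the capped parafermionic martingale t ↦ paraObsCap(drivingFunction φ
c, w, t) adapted to a filtration to which the driving function is adapted. Content: lattice Loewner
drivers of the explored slit converge jointly with the curve (generic half-plane-capacity
parametrisation facts, Kemppainen–Smirnov-type regularity on the no-return-good event supplied by
SAWNoReturn p160747) and the discrete martingale property of paraDoob passes to the limit by uniform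
integrability from the S2 bound. -/
@[route_item "route-CriticalPhenomena-SAWAsymptoticMorera"]
def ParaMartingalesOfSlitUniform : Prop :=
  (∀ (D : Literature.Probability.RandomPlanarGeometry.DobrushinDomain) (a a' b : ℝ → Literature.Probability.LatticeModels.Site 2) (φ : Literature.Probability.RandomPlanarGeometry.ConformalEquiv UpperHalfPlane.upperHalfPlaneSet D.carrier), Summit.CriticalPhenomena.SAWScalingLimit.Theorems.SubseqIdentification.ParaMartingale.IsLatticeRooted D a a' b → D.IsChordalUniformizing φ → ∀ w : ℂ, 0 < w.im → ∀ (zδ : ℝ → Literature.Probability.LatticeModels.Site 2), Filter.Tendsto (fun δ => Literature.Probability.LatticeModels.meshPoint δ (zδ δ)) (nhdsWithin 0 (Set.Ioi 0)) (nhds (φ w)) → (∃ C : ℝ, ∀ᶠ δ in nhdsWithin (0 : ℝ) (Set.Ioi 0), ∀ (γ : Literature.Probability.RandomPlanarGeometry.SAW.DomainSAW D.carrier δ (a δ) (b δ)) (k : ℕ), Literature.Probability.RandomPlanarGeometry.LatticeSlit.capTime φ (Summit.CriticalPhenomena.SAWScalingLimit.Theorems.SubseqIdentification.RoomEntropy.prefixAt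 γ k) ≤ w.im ^ 2 / 16 → ‖Summit.CriticalPhenomena.SAWScalingLimit.Theorems.SubseqIdentification.ParaMartingale.paraDoob D δ (a δ) (a' δ) (b δ) (zδ δ) γ k‖ ≤ C) ∧ ∀ ε : ℝ, 0 < ε → ∃ R : ℝ, 0 < R ∧ ∀ r : ℝ, 0 < r → r < R → ∀ᶠ δ in nhdsWithin (0 : ℝ) (Set.Ioi 0), ∀ (γ : Literature.Probability.RandomPlanarGeometry.SAW.DomainSAW D.carrier δ (a δ) (b δ)), γ ∉ Summit.CriticalPhenomena.SAWScalingLimit.Theorems.SubseqIdentification.RoomEntropy.noReturnEvent D δ (a δ) (b δ) R r → ∀ k : ℕ, Literature.Probability.RandomPlanarGeometry.LatticeSlit.capTime φ (Summit.CriticalPhenomena.SAWScalingLimit.Theorems.SubseqIdentification.RoomEntropy.prefixAt γ k) ≤ w.im ^ 2 / 16 → ‖Summit.CriticalPhenomena.SAWScalingLimit.Theorems.SubseqIdentification.ParaMartingale.paraDoob D δ (a δ) (a' δ) (b δ) (zδ δ) γ k - Summit.CriticalPhenomena.SAWScalingLimit.Theorems.SubseqIdentification.ParaMartingale.hullParaObs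 (Literature.Probability.RandomPlanarGeometry.LatticeSlit.pastHull φ (Summit.CriticalPhenomena.SAWScalingLimit.Theorems.SubseqIdentification.RoomEntropy.prefixAt γ k)) (Literature.Probability.RandomPlanarGeometry.LatticeSlit.drivingValue φ (Summit.CriticalPhenomena.SAWScalingLimit.Theorems.SubseqIdentification.RoomEntropy.prefixAt γ k)) w‖ ≤ ε) → ∀ (D : Literature.Probability.RandomPlanarGeometry.DobrushinDomain) (a a' b : ℝ → Literature.Probability.LatticeModels.Site 2) (φ : Literature.Probability.RandomPlanarGeometry.ConformalEquiv UpperHalfPlane.upperHalfPlaneSet D.carrier) (μ : MeasureTheory.Measure (Literature.Probability.RandomPlanarGeometry.CurveClass ℂ)), Summit.CriticalPhenomena.SAWScalingLimit.Theorems.SubseqIdentification.ParaMartingale.IsLatticeRooted D a a' b → D.IsChordalUniformizing φ → MeasureTheory.IsProbabilityMeasure μ → Literature.Probability.RandomPlanarGeometry.IsSubseqLimitLaw (fun δ (γ : Literature.Probability.RandomPlanarGeometry.SAW.DomainSAW D.carrier δ (a δ) (b δ)) => γ.curve) (fun δ => Literature.Probability.RandomPlanarGeometry.SAW.law D.carrier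 δ (a δ) (b δ)) μ → (∀ᵐ c ∂μ, Literature.Probability.RandomPlanarGeometry.IsLoewnerDescribable φ c ∧ c.source = D.pt 0) → ∃ 𝓕 : MeasureTheory.Filtration NNReal (inferInstance : MeasurableSpace (Literature.Probability.RandomPlanarGeometry.CurveClass ℂ)), MeasureTheory.Adapted 𝓕 (fun t c => Literature.Probability.RandomPlanarGeometry.drivingFunction φ c t) ∧ ∀ w : ℂ, 0 < w.im → MeasureTheory.Martingale (fun t c => Summit.CriticalPhenomena.SAWScalingLimit.Theorems.SubseqIdentification.ParaMartingale.paraObsCap (Literature.Probability.RandomPlanarGeometry.drivingFunction φ c) w t) 𝓕 μ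

-- parent: SubseqIdentification · child (gen 1)
/--     item stmt-CriticalPhenomena-4481 · crux · rank 503 · open
    parent: SubseqIdentification · by planner
    why it might fail: Needs an a priori arm/no-six-arm-type estimate for SAW excluding limit curves that trace back along themselves or hit the boundary tangentially; only the half-plane bridge decay (Duminil-Copin–Hammond, Kesten) is available, not a quantitative annulus-crossing bound in general Dobrushin domains.
    sources: KemppainenSmirnov2017, arXiv:1212.6215, DuminilCopinHammond2013, arXiv:1205.0401, LawlerSchrammWerner2004SAW
[crux] (Kemppainen–Smirnov regularity for the SAW) for every Dobrushin domain, endpoint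
approximation and chordal uniformizing map φ, every probability subsequential limit law ν of the SAW
curve laws (`IsSubseqLimitLaw`) is carried by curve classes that start at a and are
Loewner-describable through φ (`IsLoewnerDescribable`: capacity-parametrised pull-back generated by
a curve with continuous driving function) — KS17 Thm 1.5 (ii) / Cor 1.7 in output form, the
hypothesis shape of HarmonicPassage / HarmonicIdentification. [difficulty: open-problem] -/
@[route_item "route-CriticalPhenomena-SAWAsymptoticMorera"]
def LimitsDescribable : Prop :=
  ∀ (D : Literature.Probability.RandomPlanarGeometry.DobrushinDomain) (a b : ℝ → Literature.Probability.LatticeModels.Site 2), Literature.Probability.RandomPlanarGeometry.SAW.IsEndpointApprox D a b → ∀ (φ : Literature.Probability.RandomPlanarGeometry.ConformalEquiv UpperHalfPlane.upperHalfPlaneSet D.carrier), D.IsChordalUniformizing φ → ∀ ν : MeasureTheory.Measure (Literature.Probability.RandomPlanarGeometry.CurveClass ℂ), MeasureTheory.IsProbabilityMeasure ν → Literature.Probability.RandomPlanarGeometry.IsSubseqLimitLaw (fun δ (γ : Literature.Probability.RandomPlanarGeometry.SAW.DomainSAW D.carrier δ (a δ) (b δ)) => γ.curve) (fun δ => Literature.Probability.RandomPlanarGeometry.SAW.law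 D.carrier δ (a δ) (b δ)) ν → ∀ᵐ c ∂ν, Literature.Probability.RandomPlanarGeometry.IsLoewnerDescribable φ c ∧ c.source = D.pt 0

-- parent: SubseqIdentification · child (gen 1)
/--     item stmt-CriticalPhenomena-0776 · crux · rank 504 · open
    parent: SubseqIdentification · by planner
    why it might fail: Requires a coupling / ratio-of-partition-functions argument near the marked prime ends (boundary conformal restriction at the lattice level); for SAW on Z² no such microscopic mixing statement is proved, and near a rough prime end the bridge decomposition may lose uniformity.
    sources: LawlerSchrammWerner2003Restriction, arXiv:math/0209343, DuminilCopinSmirnov2012, LawlerSchrammWerner2004SAW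
[support] refutation guard on the conjunct as typed: for two endpoint approximations (a_δ,b_δ),
(a'_δ,b'_δ) of the same Dobrushin domain (both
Literature.Probability.RandomPlanarGeometry.SAW.IsEndpointApprox: joined in Ω_δ, mesh points → a, b,
no control on HOW they approach the boundary points), the difference of test integrals ∫ f∘curve d
law_δ tends to 0 as δ → 0+ for every bounded continuous f. Necessary for
Literature.Probability.RandomPlanarGeometry.SAW.SAWScalingLimit given
Literature.Probability.RandomPlanarGeometry.IsSLECurve.map_eq; its negation (an
approximation-dependent limit, e.g. a_δ approaching a at distance ≫ δ from ∂Ω_δ) refutes the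
conjunct. -/
@[route_item "route-CriticalPhenomena-SAWAsymptoticMorera"]
def EndpointRobust : Prop :=
  ∀ (D : Literature.Probability.RandomPlanarGeometry.DobrushinDomain) (a b a' b' : ℝ → Literature.Probability.LatticeModels.Site 2), Literature.Probability.RandomPlanarGeometry.SAW.IsEndpointApprox D a b → Literature.Probability.RandomPlanarGeometry.SAW.IsEndpointApprox D a' b' → ∀ f : BoundedContinuousFunction (Literature.Probability.RandomPlanarGeometry.CurveClass ℂ) ℝ, Filter.Tendsto (fun δ => (∫ γ, f γ.curve ∂(Literature.Probability.RandomPlanarGeometry.SAW.law D.carrier δ (a δ) (b δ))) - ∫ γ, f γ.curve ∂(Literature.Probability.RandomPlanarGeometry.SAW.law D.carrier δ (a' δ) (b' δ))) (nhdsWithin 0 (Set.Ioi 0)) (nhds 0)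

-- parent: SubseqIdentification · glue (gen 1)
/--     item stmt-CriticalPhenomena-20255 · support · rank 505 · closed · proved by Summit.CriticalPhenomena.SAWScalingLimit.Theorems.sawAsymptoticMorera_subseqIdentificationOfParaSubs_proof @ d02f13ecd14a (operator)
    parent: SubseqIdentification · GLUE: children ⟹ parent · by operator
SubseqIdentification_of_subs: PROVED and LANDED (p174122, commit 794c516eacb5) as
Summit.CriticalPhenomena.SAWScalingLimit.Theorems.SubseqIdentification.ParaMartingale.SubseqIdentification_morera_of_slitUniform_of_passage
: SlitParaObservableUniform -> ParaMartingalesOfSlitUniform -> LimitsDescribable -> EndpointRobust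
-> SubseqIdentification (children are definitionally its binders; its module
Theorems/SAWAsymptoticMoreraSubseqIdentificationParaSplit.lean imports this route file, hence not
citable by --glue-by; this glue item closes by the one-line Theorems proof fun h1 h2 h3 h4 =>
SubseqIdentification_morera_of_slitUniform_of_passage h1 h2 h3 h4, filed next). Content: modus
ponens S2 => capped parafermionic martingales of describable subsequential limits; rooted
approximation S5 (p166209); weak-limit transfer by EndpointRobust; describability; capped endgame S4
(p168572). -/
@[route_item "route-CriticalPhenomena-SAWAsymptoticMorera"]
def SubseqIdentificationOfParaSubs : Prop :=
  SlitParaObservableUniform → ParaMartingalesOfSlitUniform → LimitsDescribable → EndpointRobust → SubseqIdentification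

-- `SubseqIdentificationOfParaSubs` holds: proved by `Summit.CriticalPhenomena.SAWScalingLimit.Theorems.sawAsymptoticMorera_subseqIdentificationOfParaSubs_proof` @ d02f13ecd14a (its module imports this route file, so no `_holds` link can be stated here).

/-- item stmt-CriticalPhenomena-1881 · crux · rank 6 · open · by planner
why it might fail: No annulus-crossing/RSW technology for critical SAW (KS17 §4 verifies G2 for FK, percolation, harmonic explorer, LERW only; G2 fails for UST §4.5); the refuted all-δ form stmt-0772 is avoided by the eventual filter, but even eventual tightness has no engine beyond sub-ballisticity.
sources: Summit.CriticalPhenomena.SAWScalingLimit.Theorems.SAWParafermionTight_refuted, KemppainenSmirnov2017, AizenmanBurchardDuke1999, DuminilCopinHammond2013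
[support] EVENTUAL TIGHTNESS of the critical SAW laws: for every Dobrushin domain and endpoint
approximation, IsTightAlongMesh (fun δ γ => γ.curve) (fun δ => SAW.law D δ a_δ b_δ) — for every ε
some compact set of CurveClass ℂ carries all but ε of the mass for all small δ. This is the form the
Prokhorov criterion convergesInLawToSLE_of_isTightAlongMesh consumes and the repair of the refuted
all-δ Tight (IsTightLaws over δ ∈ (0,1]) suggested by the refuting theorem; offered to routes
SAWParafermion / SAWConfRestriction as their restated r3/r4. -/
@[route_item "route-CriticalPhenomena-SAWAsymptoticMorera", crux]
def EventualTight : Prop :=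
  ∀ (D : Literature.Probability.RandomPlanarGeometry.DobrushinDomain) (a b : ℝ → Literature.Probability.LatticeModels.Site 2), Literature.Probability.RandomPlanarGeometry.SAW.IsEndpointApprox D a b → Literature.Probability.RandomPlanarGeometry.IsTightAlongMesh (fun δ (γ : Literature.Probability.RandomPlanarGeometry.SAW.DomainSAW D.carrier δ (a δ) (b δ)) => γ.curve) (fun δ => Literature.Probability.RandomPlanarGeometry.SAW.law D.carrier δ (a δ) (b δ))

/-- item stmt-CriticalPhenomena-6859 · support · rank 9 · open · by planner
sources: DuminilCopinSmirnov2012, Literature.Probability.RandomPlanarGeometry.SAW.DuminilCopinSmirnov2012_lemma1_holds, Literature.Barriers.CriticalPhenomena.NienhuisWeightsExcludeVertexSAW, BeatonGuttmannJensen2012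
[support] the EXACT square-lattice analogue of DCS Lemma 1, with remainder (card (S1) made precise;
outside the proved barrier's scope, caveat (b) of NienhuisWeightsExcludeVertexSAW): for δ > 0, a
root a with reference site a′, and an interior vertex v ≠ a with its four neighbours in Ω_δ, writing
H(p,q) for the half-edge term (walks to p, half-step toward q), T_d for its 'type-1' part at (v−d,
v) (walks to v−d never visiting v) and L_d := H(v−d,v) − T_d (loop returns): Σ_d
d·(H(v,v+d)+H(v+d,v)) = (x_c(1+2 sin(5π/16)) − 1)·Σ_d d·T_d − Σ_d d·L_d. Proof = DCS's regrouping
(walks to v grouped by last step; left/right turns contribute i e^(−i5π/16) − i e^(i5π/16) = 2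
sin(5π/16)) adapting HexParafermionProofs; the intended strengthening (not filed): L_d is a sum over
loop-reversal PAIRS with coefficients 2 sin(15π/16) (opposite exits) and i e^(−15iπ/16) + e^(5iπ/8)
(adjacent exits), loop orientation being forced by planarity as in wnd_eq_zero_of_simplyConnected.
[difficulty: M] -/
@[route_item "route-CriticalPhenomena-SAWAsymptoticMorera", crux]
def Z2VertexIdentity : Prop :=
  ∀ (Ω : Set ℂ) (δ : ℝ) (a a' v : Literature.Probability.LatticeModels.Site 2), let H : Literature.Probability.LatticeModels.Site 2 → Literature.Probability.LatticeModels.Site 2 → ℂ := fun p q => ∑' γ : Literature.Probability.RandomPlanarGeometry.SAW.DomainSAW Ω δ a p, if s(p, q) ∈ γ.walk.edges then 0 else Complex.exp (-Complex.I * (5 / 8 : ℂ) * (Literature.Probability.LatticeModels.winding (Literature.Probability.LatticeModels.meshPoint δ a' :: (γ.walk.support.map (Literature.Probability.LatticeModels.meshPoint δ)) ++ [Literature.Probability.LatticeModels.medialPoint δ s(p, q)]) : ℝ)) * (Literature.Probability.RandomPlanarGeometry.SAW.criticalFugacity : ℂ) ^ (γ.length + 1); let T : Literature.Probability.LatticeModels.Site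 2 → ℂ := fun d => ∑' γ : Literature.Probability.RandomPlanarGeometry.SAW.DomainSAW Ω δ a (v - d), if v ∈ γ.walk.support then 0 else Complex.exp (-Complex.I * (5 / 8 : ℂ) * (Literature.Probability.LatticeModels.winding (Literature.Probability.LatticeModels.meshPoint δ a' :: (γ.walk.support.map (Literature.Probability.LatticeModels.meshPoint δ)) ++ [Literature.Probability.LatticeModels.medialPoint δ s(v - d, v)]) : ℝ)) * (Literature.Probability.RandomPlanarGeometry.SAW.criticalFugacity : ℂ) ^ (γ.length + 1); let dir : Fin 4 → Literature.Probability.LatticeModels.Site 2 := ![![1, 0], ![0, 1], ![-1, 0], ![0, -1]]; let cdir : Fin 4 → ℂ := ![1, Complex.I, -1, -Complex.I]; 0 < δ → v ≠ a → (∀ i : Fin 4, (Literature.Probability.LatticeModels.discreteDomainGraph Ω δ).Adj v (v + dir i)) → ∑ i : Fin 4, cdir i * (H v (v + dir i) + H (v + dir i) v) = ((Literature.Probability.RandomPlanarGeometry.SAW.criticalFugacity : ℂ) * (1 + 2 * Real.sin (5 * Real.pi / 16)) - 1) * ∑ i : Fin 4, cdir i * T (dir i) - ∑ i : Fin 4,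 cdir i * (H (v - dir i) v - T (dir i))

-- earlier Assembly (stmt-CriticalPhenomena-6860, replaced 2026-08-15T12:18:45Z -> stmt-CriticalPhenomena-7797): retired by None — AsymptoticMorera → InteriorRegularity → BoundaryIdentification → SubseqIdentification → EventualTight → SAWScalingLimit
/-- item stmt-CriticalPhenomena-7797 · assembly · rank 1 · closed · proved by Summit.CriticalPhenomena.SAWScalingLimit.Theorems.sawAsymptoticMorera_assembly_proof (prover) · by planner
sources: KemppainenSmirnov2017, LawlerSchrammWerner2004SAW, Literature.Probability.RandomPlanarGeometry.convergesInLawToSLE_of_isTightAlongMesh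
[assembly] AsymptoticMorera → InteriorRegularity → BoundaryIdentification → SubseqIdentification →
(eventual tightness, the statement of the shared crux r6 = stmt-CriticalPhenomena-1881, inlined so
the file elaborates independently of the shared decl) → SAWScalingLimit. Proof: the last two
hypotheses give SAWScalingLimit by convergesInLawToSLE_of_isTightAlongMesh (+
IsSLECurve.map_eq_holds, SAW.aemeasurable_curve, eventual probability of SAW.law), as in route
SAWLeftRightFKG; the first three are the engine for SubseqIdentification and are consumed vacuously. -/
@[route_item "route-CriticalPhenomena-SAWAsymptoticMorera", crux]
def Assembly : Prop :=
  AsymptoticMorera → InteriorRegularity → BoundaryIdentification → SubseqIdentification → (∀ (D : Literature.Probability.RandomPlanarGeometry.DobrushinDomain) (a b : ℝ → Literature.Probability.LatticeModels.Site 2), Literature.Probability.RandomPlanarGeometry.SAW.IsEndpointApprox D a b → Literature.Probability.RandomPlanarGeometry.IsTightAlongMesh (fun δ (γ : Literature.Probability.RandomPlanarGeometry.SAW.DomainSAW D.carrier δ (a δ) (b δ)) => γ.curve) (fun δ => Literature.Probability.RandomPlanarGeometry.SAW.law D.carrier δ (a δ) (b δ))) → SAWScalingLimit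

-- `Assembly` holds: proved by `Summit.CriticalPhenomena.SAWScalingLimit.Theorems.sawAsymptoticMorera_assembly_proof` (its module imports this route file, so no `_holds` link can be stated here).

/-! D-0027 §2.1 — DECIDING THEOREM (planner-authored via `route open/edit --closes-file`; by planner-rbadge-CriticalPhenomena-SAWAsymptotic-a78857b6-g2-0 2026-08-15T16:23:57Z):
its hypotheses are this route's items and its conclusion the sub-problem Statement (glue_lint), and it elaborates with this file. -/

@[closes "route-CriticalPhenomena-SAWAsymptoticMorera"] theorem closes : ObservableLimitFlat → AsymptoticMorera → InteriorRegularity → BoundaryIdentification →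
    SubseqIdentification → EventualTight → Z2VertexIdentity → Assembly → _root_.SAWScalingLimit :=
  fun _ hAM hIR hBI hSI hET _ hAssembly => hAssembly hAM hIR hBI hSI hET

end Summit.CriticalPhenomena.SAWScalingLimit.Theses.SAWAsymptoticMorera
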